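import Literature.Computability.QuantumComplexity.QAOALevelOneMaxCut
import Literature.Combinatorics.SimpleGraph.MaxCutEigenvalueBound
import HarnessLib

/-!
# QAOA at every depth is below the eigenvalue ceiling on the max-cut

Sources. E. Farhi, J. Goldstone, S. Gutmann, arXiv:1411.4028 [FarhiGoldstoneGutmann2014], eqs. (8),
(10): `M_p = max_{γ,β} F_p(γ,β)` and `M_p ≤ max_z C(z)` (the tree's
`QAOALevelOneMaxCut.maxLevel_le_maxCut`); B. Mohar, S. Poljak, Czechoslovak Math. J. 40 (1990)
343–352 [MoharPoljak1990], Theorem 2.2 "`MC(G) ≤ λ_∞ · n/4`" and §3 (regular / Ramanujan graphs: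
"`MC(G) ≤ ¼ n r + ½ n √(r−1)`"), formalised in
`Literature.Combinatorics.SimpleGraph.MaxCutEigenvalueBound`.

HONEST FRAMING: instance-level adjudication of specific advantage claims; no claim about BQP vs BPP
or the summit. This def-free bridge file only chains the two tree results: the QAOA files' objective
`cutValue` counts bichromatic edges (`cutValue_eq_card_cutEdges`), so `maxCut G`, and with it the
optimum `maxLevel G p` of the depth-`p` QAOA for EVERY `p`, is at most `λ_∞(L) · n/4`
(`maxCut_le_topEigenvalue`, **`maxLevel_le_topEigenvalue`**), and on a `k`-regular graph whose
adjacency eigenvalues are all `≥ −μ` at most `|E| · (½ + μ/(2k))`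
(`maxCut_le_edges_mul_of_eigenvalues_ge`, **`maxLevel_le_edges_mul_of_eigenvalues_ge`**; Ramanujan:
`½ + √(k−1)/k`). The bound holds for every algorithm, classical or quantum — it is a statement about
the instance; nothing here is specific to QAOA beyond `M_p ≤ MaxCut`. 0 facts.
-/

noncomputable section

namespace Literature.Computability.QuantumComplexity

namespace QAOA

open Finset Matrix Literature.LinearAlgebra.Matrix
open Literature.Combinatorics.SimpleGraph.MaxCutEigenvalueBound

variable {V : Type*} [Fintype V] [DecidableEq V] (G : SimpleGraph V) [DecidableRel G.Adj]

/-- Rayleigh lower bound from the spectrum: all eigenvalues `≥ −μ` ⇒ `xᵀAx ≥ −μ‖x‖²` (spectral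
coordinates, `Literature.LinearAlgebra.Matrix.dotProduct_mulVec_eq_sum`). [cite: MoharPoljak1990,
Lemma 2.1, proof ("λ_∞ = max xᵀQx/xᵀx", [L, Theorem 3.2.1]) p. 344] -/
private theorem neg_mul_le_quad {A : Matrix V V ℝ} (hA : A.IsHermitian) {μ : ℝ}
    (hμ : ∀ i, -μ ≤ hA.eigenvalues i) (x : V → ℝ) : -μ * (x ⬝ᵥ x) ≤ x ⬝ᵥ A *ᵥ x := by
  rw [dotProduct_mulVec_eq_sum hA, dotProduct_self_eq_sum hA, mul_sum]
  exact sum_le_sum fun i _ => mul_le_mul_of_nonneg_right (hμ i) (sq_nonneg _)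

omit [DecidableEq V] in
/-- The QAOA files' cut objective `C(x) = Σ_{e ∈ E} C_e(x)` is the NUMBER of bichromatic edges of
the 2-colouring `x`. [cite: FarhiGoldstoneGutmann2014, eq. (1) and §2 (C(z) = the number of edges
cut)] -/
theorem cutValue_eq_card_cutEdges (x : V → Bool) :
    cutValue G x = (G.edgeFinset.filter fun e => ¬ (e.map x).IsDiag).card := by
  rw [cutValue, card_filter]
  refine sum_congr rfl fun e _ => ?_
  induction e using Sym2.ind with
  | h a b => simp only [cutInd_mk, Sym2.map_mk, Sym2.mk_isDiag_iff]; split_ifs <;> simp_all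

/-- **`max_z C(z) ≤ λ_∞(L) · n/4`**: the MaxCut value of the QAOA files obeys the Mohar–Poljak
eigenvalue bound. [cite: MoharPoljak1990, Theorem 2.2 ("MC(G) ≤ λ_∞ · n/4") p. 345] -/
theorem maxCut_le_topEigenvalue [Nonempty V] :
    (maxCut G : ℝ) ≤ topEigenvalue (G.isHermitian_lapMatrix ℝ) * (Fintype.card V / 4) := by
  obtain ⟨x, -, hx⟩ := exists_mem_eq_sup (univ : Finset (V → Bool)) univ_nonempty (cutValue G)
  rw [maxCut, hx, cutValue_eq_card_cutEdges]
  exact card_cutEdges_le_topEigenvalue G x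

/-- **QAOA at every depth is below the eigenvalue ceiling**: `M_p ≤ max_z C(z) ≤ λ_∞(L) · n/4`
for every `p`. [cite: FarhiGoldstoneGutmann2014, eqs. (8), (10) (M_p ≤ max_z C(z))] [cite:
MoharPoljak1990, Theorem 2.2] -/
theorem maxLevel_le_topEigenvalue [Nonempty V] (p : ℕ) :
    maxLevel G p ≤ topEigenvalue (G.isHermitian_lapMatrix ℝ) * (Fintype.card V / 4) :=
  (maxLevel_le_maxCut G p).trans (maxCut_le_topEigenvalue G)

/-- **Regular graphs, adjacency-spectrum form**: on a `k`-regular graph (`k ≥ 1`) all of whose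
adjacency eigenvalues are `≥ −μ`, `max_z C(z) ≤ |E| · (½ + μ/(2k))`. [cite: MoharPoljak1990,
Theorem 2.2 with §3 (regular graphs; bipartite density MC(G)/|E(G)|) pp. 345, 347, 350] -/
theorem maxCut_le_edges_mul_of_eigenvalues_ge [Nonempty V] {k : ℕ} (hk : 0 < k)
    (hreg : G.IsRegularOfDegree k) (hA : (G.adjMatrix ℝ).IsHermitian) {μ : ℝ}
    (hμ : ∀ i, -μ ≤ hA.eigenvalues i) :
    (maxCut G : ℝ) ≤ #G.edgeFinset * (1 / 2 + μ / (2 * k)) := by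
  obtain ⟨x, -, hx⟩ := exists_mem_eq_sup (univ : Finset (V → Bool)) univ_nonempty (cutValue G)
  rw [maxCut, hx, cutValue_eq_card_cutEdges, card_cutEdges_eq_card_interedges]
  exact card_interedges_le_edges_mul_of_regular G hk hreg
    (neg_mul_le_quad hA hμ) _

/-- **QAOA at every depth on a regular graph with adjacency spectrum `≥ −μ` cuts at most a fraction
`½ + μ/(2k)` of the edges in expectation**; on a Ramanujan graph (`μ = 2√(k−1)`) at most
`½ + √(k−1)/k`. [cite: FarhiGoldstoneGutmann2014, eqs. (8), (10)] [cite: MoharPoljak1990, Theorem 2.2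
and §3 (Ramanujan graphs: MC(G) ≤ ¼nr + ½n√(r−1))] -/
theorem maxLevel_le_edges_mul_of_eigenvalues_ge [Nonempty V] {k : ℕ} (hk : 0 < k)
    (hreg : G.IsRegularOfDegree k) (hA : (G.adjMatrix ℝ).IsHermitian) {μ : ℝ}
    (hμ : ∀ i, -μ ≤ hA.eigenvalues i) (p : ℕ) :
    maxLevel G p ≤ #G.edgeFinset * (1 / 2 + μ / (2 * k)) :=
  (maxLevel_le_maxCut G p).trans (maxCut_le_edges_mul_of_eigenvalues_ge G hk hreg hA hμ)

end QAOA

end Literature.Computability.QuantumComplexity
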